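import Literature.MathematicalPhysics.KineticTheory.HardSphereEulerProofs
import HarnessLib

/-!
# Messenger sparsity under a local Gibbs law (stub `stub_messengerSparsity`)

Crux `Summit.AtomisticToContinuum.HydrodynamicLimit.Theses.OneFlightGossipEngine.ClampedCurrentsDock`
(stmt-AtomisticToContinuum-14680), line `IdeatorTwoSketch`, stub `stub_messengerSparsity : MessengerSparsity`
(card `clamp-buys-locality`, input of the localisation step S5b). Influence across a corridor within one
kinetic window is carried only by MESSENGERS — particles whose peculiar speed `‖v_i − u₀(x_i)‖` exceeds
`R`. `MessengerSparsity` is re-declared verbatim from the line skeleton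
`Cruxes/ClampedCurrentsDock/Lines/IdeatorTwoSketch.lean`.

## Proof

Under the canonical local Gibbs law (density `∝ 𝟙{hard core} ∏ᵢ a(xᵢ) M_{1,u₀(xᵢ),θ₀(xᵢ)}(vᵢ)`) the
velocities are, CONDITIONALLY ON THE POSITIONS, independent local Maxwellians
(`lintegral_localGibbsMeasure`: the velocity fibre is `velMeasure u₀ θ₀ x = ⊗ᵢ N(u₀(xᵢ), θ₀(xᵢ) id)`).
Hence the messenger count `Σᵢ 𝟙{R < ‖vᵢ − u₀(xᵢ)‖}` is, given the positions, a sum of independent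
Bernoulli variables with success probabilities `pᵢ = ∫ 𝟙{R < ‖v − u₀(xᵢ)‖} M_{xᵢ}(v) dv ≤ p`, and its
conditional moment generating function at a tilt `λ ≥ 0` is
`∏ᵢ (1 + (e^λ − 1) pᵢ) ≤ exp((e^λ − 1) Σᵢ pᵢ) ≤ exp((e^λ − 1)(N+1)p)` (`1 + x ≤ eˣ`;
`lintegral_exp_mul_bernoulli_le`, `lintegral_pi_exp_sum_le`). Integrating the conditional bound over the
positions against the position marginal, a probability weight for `σ ≤ 1/2`
(`isProbabilityMeasure_localGibbsMeasure`, `lintegral_posWeight_eq_one`), gives the claim.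
-/

noncomputable section

open MeasureTheory Filter Set Topology
open Literature.MathematicalPhysics.KineticTheory Literature.Analysis.FluidPDE Literature.Analysis.FunctionSpaces

namespace Summit.AtomisticToContinuum.HydrodynamicLimit.Theorems.ClampedCurrentsDockMessenger

open scoped ENNReal

/-! ## The statement (verbatim from the line skeleton) -/

/-- **S14 — messenger sparsity under a local Gibbs law (static; worker-sized; card `clamp-buys-locality`).** Under
the canonical local Gibbs law the velocities are, conditionally on the positions, independent local Maxwellians; hence
the number of MESSENGERS — particles whose peculiar speed `‖v_i − u₀(x_i)‖` exceeds `R` — is a sum of conditionally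
independent Bernoulli variables with success probabilities `≤ p` (`p` any uniform bound of the one-particle tail
`∫ 1{R < ‖v − u₀(x)‖} M_{1,u₀(x),θ₀(x)}(v) dv`), and its exponential moment at EVERY tilt `λ ≥ 0` is at most
`exp((e^λ − 1)(N+1)p)` (`bernoulliTiltBound` of the sketch, integrated over the positions). With `p → 0` as `R → ∞`
this is `e^{o(N)}` at every fixed tilt: what replaces "finite speed of influence" in the localisation S5b. -/
def MessengerSparsity : Prop :=
  ∀ (σ : ℝ) (a θ₀ : T3 → ℝ) (u₀ : T3 → V3), Continuous a → Continuous θ₀ → Continuous u₀ →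
    (∀ x, 0 < a x) → (∀ x, 0 < θ₀ x) → 0 < σ → σ ≤ 1 / 2 →
    ∀ (N : ℕ) (Φ : HardSphereFlow (Torus.geometry (Fin 3)) (hsDiameter σ N) (N + 1)) (R lam p : ℝ),
      0 < R → 0 ≤ lam → 0 ≤ p →
      (∀ x, ∫ v, (if R < ‖v - u₀ x‖ then (1 : ℝ) else 0) * localMaxwellian 1 (θ₀ x) (u₀ x) v ≤ p) →
      ∫⁻ z, ENNReal.ofReal (Real.exp (lam *
          ∑ i : Fin (N + 1), (if R < ‖(z i).2 - u₀ (z i).1‖ then (1 : ℝ) else 0)))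
        ∂(localGibbsLaw σ a u₀ θ₀ N Φ) ≤
      ENNReal.ofReal (Real.exp ((Real.exp lam - 1) * (((N : ℝ) + 1) * p)))

/-! ## The Bernoulli tilt bound -/

/-- **One Bernoulli factor.** For a probability measure `γ`, a measurable `{0,1}`-valued `g` with
`∫ g dγ ≤ p` and a tilt `λ ≥ 0`: `∫ e^{λ g} dγ = 1 + (e^λ − 1) ∫ g dγ ≤ 1 + (e^λ − 1) p ≤ exp((e^λ − 1) p)`.
[folklore] -/
theorem lintegral_exp_mul_bernoulli_le {V : Type*} [MeasurableSpace V] (γ : Measure V)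
    [IsProbabilityMeasure γ] {g : V → ℝ} (hgm : Measurable g) (hg : ∀ w, g w = 0 ∨ g w = 1)
    {lam p : ℝ} (hlam : 0 ≤ lam) (hp : ∫ w, g w ∂γ ≤ p) :
    ∫⁻ w, ENNReal.ofReal (Real.exp (lam * g w)) ∂γ ≤
      ENNReal.ofReal (Real.exp ((Real.exp lam - 1) * p)) := by
  have hc : 0 ≤ Real.exp lam - 1 := by linarith [Real.one_le_exp hlam]
  -- `e^{λ g} = 1 + (e^λ - 1) g` on `{0, 1}`
  have hpt : ∀ w, Real.exp (lam * g w) = 1 + (Real.exp lam - 1) * g w := by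
    intro w
    rcases hg w with h | h
    · rw [h, mul_zero, Real.exp_zero, mul_zero, add_zero]
    · rw [h, mul_one, mul_one, add_sub_cancel]
  have hgi : Integrable g γ :=
    Integrable.of_bound hgm.aestronglyMeasurable 1 (ae_of_all _ fun w => by
      rcases hg w with h | h <;> simp [h])
  have hfun : (fun w => Real.exp (lam * g w)) = fun w => 1 + (Real.exp lam - 1) * g w := funext hpt
  have hei : Integrable (fun w => Real.exp (lam * g w)) γ := by
    rw [hfun]
    exact (integrable_const _).add (hgi.const_mul _)
  rw [← ofReal_integral_eq_lintegral_ofReal hei (ae_of_all _ fun w => (Real.exp_pos _).le)]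
  refine ENNReal.ofReal_le_ofReal ?_
  calc ∫ w, Real.exp (lam * g w) ∂γ = ∫ w, (1 + (Real.exp lam - 1) * g w) ∂γ := by rw [hfun]
    _ = 1 + (Real.exp lam - 1) * ∫ w, g w ∂γ := by
        rw [integral_add (integrable_const _) (hgi.const_mul _), integral_const, integral_const_mul]
        simp
    _ ≤ 1 + (Real.exp lam - 1) * p := by gcongr
    _ ≤ Real.exp ((Real.exp lam - 1) * p) := by
        linarith [Real.add_one_le_exp ((Real.exp lam - 1) * p)]

/-- **Bernoulli tilt bound on a finite product of probability spaces.** For independent coordinates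
`vᵢ ∼ μᵢ` and measurable `{0,1}`-valued `gᵢ` with `∫ gᵢ dμᵢ ≤ p`, at every tilt `λ ≥ 0`,
`∫ exp(λ Σᵢ gᵢ(vᵢ)) d(⊗ᵢ μᵢ) = ∏ᵢ ∫ e^{λ gᵢ} dμᵢ ≤ exp((e^λ − 1) · #ι · p)` (Tonelli on the product and
`lintegral_exp_mul_bernoulli_le`). [folklore] -/
theorem lintegral_pi_exp_sum_le {ι : Type*} [Fintype ι] {V : Type*} [MeasurableSpace V]
    (μ : ι → Measure V) [∀ i, IsProbabilityMeasure (μ i)] {g : ι → V → ℝ}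
    (hgm : ∀ i, Measurable (g i)) (hg : ∀ i w, g i w = 0 ∨ g i w = 1) {lam p : ℝ} (hlam : 0 ≤ lam)
    (hp : ∀ i, ∫ w, g i w ∂μ i ≤ p) :
    ∫⁻ v, ENNReal.ofReal (Real.exp (lam * ∑ i, g i (v i))) ∂Measure.pi μ ≤
      ENNReal.ofReal (Real.exp ((Real.exp lam - 1) * (Fintype.card ι * p))) := by
  -- the integral factorises
  have hprod : ∫⁻ v, ENNReal.ofReal (Real.exp (lam * ∑ i, g i (v i))) ∂Measure.pi μ =
      ∏ i, ∫⁻ w, ENNReal.ofReal (Real.exp (lam * g i w)) ∂μ i := by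
    rw [← lintegral_fintype_prod_eq_prod' μ (f := fun i w => ENNReal.ofReal (Real.exp (lam * g i w)))
      (fun i => (measurable_const.mul (hgm i)).exp.ennreal_ofReal)]
    refine lintegral_congr fun v => ?_
    rw [Finset.mul_sum, Real.exp_sum, ENNReal.ofReal_prod_of_nonneg fun i _ => (Real.exp_pos _).le]
  rw [hprod]
  calc ∏ i, ∫⁻ w, ENNReal.ofReal (Real.exp (lam * g i w)) ∂μ i
      ≤ ∏ _i : ι, ENNReal.ofReal (Real.exp ((Real.exp lam - 1) * p)) :=
        Finset.prod_le_prod' fun i _ => lintegral_exp_mul_bernoulli_le (μ i) (hgm i) (hg i) hlam (hp i)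
    _ = ENNReal.ofReal (Real.exp ((Real.exp lam - 1) * (Fintype.card ι * p))) := by
        rw [Finset.prod_const, Finset.card_univ, ← ENNReal.ofReal_pow (Real.exp_pos _).le,
          ← Real.exp_nat_mul]
        congr 2
        ring

/-! ## The Maxwellian tail is a Gaussian probability -/

/-- Integration against the isotropic Gaussian `N(u, θ id)` on `ℝ³` is integration against the local
Maxwellian density `M_{1,u,θ}` (`θ > 0`; the transfer identities `integral_gaussMeasure` and
`integral_localMaxwellian_smul`). [folklore] -/
theorem integral_gaussMeasure_eq_integral_mul_localMaxwellian {θ : ℝ} (hθ : 0 < θ) (u : V3)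
    (g : V3 → ℝ) :
    ∫ v, g v ∂gaussMeasure u θ = ∫ v, g v * localMaxwellian 1 θ u v := by
  rw [integral_gaussMeasure u hθ g, ← integral_localMaxwellian_smul hθ u g]
  simp_rw [smul_eq_mul, mul_comm]

/-! ## Messenger sparsity under the local Gibbs measure -/

section LocalGibbs

variable {a₀ θ₀ : T3 → ℝ} {u₀ : T3 → V3}

/-- **Exponential moment of a Bernoulli count under the local Gibbs measure.** For a jointly measurable
family of `{0,1}`-valued one-body velocity observables `g x : ℝ³ → ℝ` with Gaussian means
`∫ g(x, ·) dN(u₀(x), θ₀(x) id) ≤ p` uniformly in `x`, and a tilt `λ ≥ 0`: when the local Gibbs measure is a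
probability measure, `∫ exp(λ Σᵢ g(xᵢ, vᵢ)) dλ_N ≤ exp((e^λ − 1)(N+1)p)` — conditionally on the positions the
velocities are independent Gaussians (`lintegral_localGibbsMeasure`), the conditional bound is
`lintegral_pi_exp_sum_le`, and the position marginal has mass one (`lintegral_posWeight_eq_one`). [folklore] -/
theorem lintegral_exp_sum_localGibbsMeasure_le (ha : Continuous a₀) (hθ : Continuous θ₀)
    (hu : Continuous u₀) (ha0 : ∀ x, 0 ≤ a₀ x) (hθ0 : ∀ x, 0 < θ₀ x) (σ : ℝ) (N : ℕ)
    [IsProbabilityMeasure (localGibbsMeasure σ a₀ u₀ θ₀ N)]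
    {g : T3 → V3 → ℝ} (hgm : Measurable fun q : T3 × V3 => g q.1 q.2)
    (hg : ∀ x w, g x w = 0 ∨ g x w = 1) {lam p : ℝ} (hlam : 0 ≤ lam)
    (hp : ∀ x, ∫ w, g x w ∂gaussMeasure (u₀ x) (θ₀ x) ≤ p) :
    ∫⁻ z, ENNReal.ofReal (Real.exp (lam * ∑ i : Fin (N + 1), g (z i).1 (z i).2))
        ∂localGibbsMeasure σ a₀ u₀ θ₀ N ≤
      ENNReal.ofReal (Real.exp ((Real.exp lam - 1) * (((N : ℝ) + 1) * p))) := by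
  have hGm : Measurable fun z : Config (N + 1) (Fin 3) T3 =>
      ENNReal.ofReal (Real.exp (lam * ∑ i : Fin (N + 1), g (z i).1 (z i).2)) :=
    (measurable_const.mul (Finset.measurable_sum _ fun i _ =>
      hgm.comp (measurable_pi_apply i))).exp.ennreal_ofReal
  -- conditional (velocity) bound, uniformly in the positions
  have hvel : ∀ x : Fin (N + 1) → T3,
      ∫⁻ v, ENNReal.ofReal (Real.exp (lam * ∑ i : Fin (N + 1),
          g (zipConfig (x, v) i).1 (zipConfig (x, v) i).2)) ∂velMeasure u₀ θ₀ x ≤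
        ENNReal.ofReal (Real.exp ((Real.exp lam - 1) * (((N : ℝ) + 1) * p))) := by
    intro x
    have h := lintegral_pi_exp_sum_le (fun i => gaussMeasure (u₀ (x i)) (θ₀ (x i)))
      (g := fun i w => g (x i) w) (fun i => hgm.comp (measurable_const.prodMk measurable_id))
      (fun i w => hg (x i) w) hlam (fun i => hp (x i))
    rw [Fintype.card_fin] at h
    push_cast at h
    simpa only [zipConfig_apply, velMeasure] using h
  have hρm : Measurable fun x : Fin (N + 1) → T3 => ENNReal.ofReal
      ((canonicalPartition (Torus.geometry (Fin 3)) (hsDiameter σ N) (N + 1)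
        (localGibbsProfile a₀ u₀ θ₀))⁻¹ * posWeight a₀ (hsDiameter σ N) (N + 1) x) :=
    (measurable_const.mul (measurable_posWeight ha _ _)).ennreal_ofReal
  -- integrate over the positions
  rw [lintegral_localGibbsMeasure ha hθ hu ha0 hθ0 σ N hGm]
  calc ∫⁻ x, ENNReal.ofReal ((canonicalPartition (Torus.geometry (Fin 3)) (hsDiameter σ N) (N + 1)
          (localGibbsProfile a₀ u₀ θ₀))⁻¹ * posWeight a₀ (hsDiameter σ N) (N + 1) x) *
          ∫⁻ v, ENNReal.ofReal (Real.exp (lam * ∑ i : Fin (N + 1),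
            g (zipConfig (x, v) i).1 (zipConfig (x, v) i).2)) ∂velMeasure u₀ θ₀ x
      ≤ ∫⁻ x, ENNReal.ofReal ((canonicalPartition (Torus.geometry (Fin 3)) (hsDiameter σ N) (N + 1)
          (localGibbsProfile a₀ u₀ θ₀))⁻¹ * posWeight a₀ (hsDiameter σ N) (N + 1) x) *
          ENNReal.ofReal (Real.exp ((Real.exp lam - 1) * (((N : ℝ) + 1) * p))) :=
        lintegral_mono fun x => mul_le_mul' le_rfl (hvel x)
    _ = ENNReal.ofReal (Real.exp ((Real.exp lam - 1) * (((N : ℝ) + 1) * p))) := by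
        rw [lintegral_mul_const _ hρm, lintegral_posWeight_eq_one ha hθ hu ha0 hθ0 σ N, one_mul]

end LocalGibbs

/-! ## The stub -/

/-- **STUB `stub_messengerSparsity`** of line `IdeatorTwoSketch` (crux `ClampedCurrentsDock`,
stmt-AtomisticToContinuum-14680): under the canonical local Gibbs law (a probability measure for
`σ ≤ 1/2`, `isProbabilityMeasure_localGibbsMeasure`; flow-free form `localGibbsLaw_eq`) the exponential moment
at tilt `λ ≥ 0` of the messenger count `Σᵢ 𝟙{R < ‖vᵢ − u₀(xᵢ)‖}` is at most `exp((e^λ − 1)(N+1)p)` whenever the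
one-particle Maxwellian tail `∫ 𝟙{R < ‖v − u₀(x)‖} M_{1,u₀(x),θ₀(x)}(v) dv` is `≤ p` uniformly in `x`
(`lintegral_exp_sum_localGibbsMeasure_le` with `g(x, v) = 𝟙{R < ‖v − u₀(x)‖}`, the Maxwellian tail being the
Gaussian probability by `integral_gaussMeasure_eq_integral_mul_localMaxwellian`). [folklore] -/
theorem stub_messengerSparsity : MessengerSparsity := by
  intro σ a θ₀ u₀ ha hθ hu ha0 hθ0 _hσ hσ2 N Φ R lam p _hR hlam _hp0 hp
  rw [localGibbsLaw_eq]
  haveI := isProbabilityMeasure_localGibbsMeasure ha hθ hu ha0 hθ0 hσ2 N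
  have hgm : Measurable fun q : T3 × V3 => (if R < ‖q.2 - u₀ q.1‖ then (1 : ℝ) else 0) := by
    refine Measurable.ite ?_ measurable_const measurable_const
    exact measurableSet_lt measurable_const
      ((measurable_snd.sub (hu.measurable.comp measurable_fst)).norm)
  have hg : ∀ (x : T3) (w : V3),
      (if R < ‖w - u₀ x‖ then (1 : ℝ) else 0) = 0 ∨ (if R < ‖w - u₀ x‖ then (1 : ℝ) else 0) = 1 := by
    intro x w
    split_ifs <;> simp
  have htail : ∀ x, ∫ w, (if R < ‖w - u₀ x‖ then (1 : ℝ) else 0) ∂gaussMeasure (u₀ x) (θ₀ x) ≤ p := by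
    intro x
    rw [integral_gaussMeasure_eq_integral_mul_localMaxwellian (hθ0 x)]
    exact hp x
  exact lintegral_exp_sum_localGibbsMeasure_le ha hθ hu (fun x => (ha0 x).le) hθ0 σ N
    (g := fun x w => if R < ‖w - u₀ x‖ then (1 : ℝ) else 0) hgm hg hlam htail

end Summit.AtomisticToContinuum.HydrodynamicLimit.Theorems.ClampedCurrentsDockMessenger

end
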